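import Mathlib
import Literature.Geometry.Lorentzian.ReggeWheelerChannels
import Literature.Geometry.Lorentzian.ReggeWheelerTortoise
import Literature.Analysis.PDE.Wave1DExteriorEnergy
import Summits.FinalStateConjecture.FinalStateConjecture.Theorems.PhotonSphereChannelsUniformPhotonSphereChannelsRPeelLadder
import Summits.FinalStateConjecture.FinalStateConjecture.Theorems.PhotonSphereChannelsUniformPhotonSphereChannelsRPeelChain
import Summits.FinalStateConjecture.FinalStateConjecture.Theorems.PhotonSphereChannelsUniformPhotonSphereChannelsRPeelDescent
import Summits.FinalStateConjecture.FinalStateConjecture.Theorems.PhotonSphereChannelsUniformPhotonSphereChannelsRPeelStaticMode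
import Summits.FinalStateConjecture.FinalStateConjecture.Theorems.PhotonSphereChannelsUniformPhotonSphereChannelsRPeelOrth

/-!
# Peeling: the iterated energy-level Darboux correspondence — stub `stub_peel` of the line
# `crum-peeling-recessive-tower` (crux `UniformPhotonSphereChannelsR`, stmt-FinalStateConjecture-14074)

Given a recessive ladder `(W, U, a)` of `V = V_{s,ℓ}` with `Q = U ℓ ≥ 0` on `(a, ∞)`, an edge
`xf > a` and a global Regge–Wheeler solution `ψ` of finite far energy at `t = 0`, `stub_peel`
produces the peeled solution `φ = θ_ℓ` of `φ_tt − φ_xx + Qφ = 0` on the half-plane `{x > a}`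
(files 5–7, 15: `ℓ` energy-level Darboux rungs, each never increasing far energies) and the
finite-energy static mode `u` of `Q` (files 8–9), and transports the `t = 0` deficit exactly:
the tower data descend through the rungs (files 10–12, 16) to a `t`-polynomial far kernel element
`p` of `V` with `E_V[ψ − p](0; x > xf) = E_Q[φ − c₀u](0; x > xf) = min_c E_Q[φ − cu](0; x > xf)`
(file 13).
-/

noncomputable section

-- the doubled `FinalStateConjecture` component is the tree's fixed summit/problem path
set_option linter.dupNamespace false

namespace Summit.FinalStateConjecture.FinalStateConjecture.Theorems.CrumPeelingRecessiveTower

open Literature.Geometry.Lorentzian Literature.Geometry.Lorentzian.ReggeWheeler MeasureTheory Filter Set Topology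
open scoped ENNReal ContDiff

/-- Level-`0` data: the three `t = 0` square-integrability clauses of a global `C²` solution with
finite far energy beyond `xf`, for a continuous positive potential. -/
theorem initial_integrable {V : ℝ → ℝ} {ψ : ℝ → ℝ → ℝ} {a xf : ℝ} (hVc : Continuous V)
    (hV0 : ∀ x, 0 ≤ V x) (hψ : ContDiff ℝ 2 (Function.uncurry ψ))
    (hfin : ∫⁻ x in Ioi xf, ENNReal.ofReal
      (deriv (fun τ => ψ τ x) 0 ^ 2 + deriv (ψ 0) x ^ 2 + V x * ψ 0 x ^ 2) ≠ ⊤) :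
    (∀ X, a < X → IntegrableOn (fun x => deriv (fun τ => ψ τ x) 0 ^ 2) (Ioi X)) ∧
    (∀ X, a < X → IntegrableOn (fun x => deriv (ψ 0) x ^ 2) (Ioi X)) ∧
    (∀ X, a < X → 1 ≤ X → IntegrableOn (fun x => (ψ 0 x / x) ^ 2) (Ioi X)) := by
  obtain ⟨ψt, ψx, -, -, -, hct, hcx, -, -, -, h1, h2, -⟩ :=
    Literature.Analysis.Calculus.exists_partials_of_contDiff_two hψ
  have hdtc : Continuous fun x => deriv (fun τ => ψ τ x) 0 := by
    have : (fun x => deriv (fun τ => ψ τ x) 0) = fun x => ψt 0 x := funext fun x => (h1 0 x).deriv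
    rw [this]; exact hct.comp (continuous_const.prodMk continuous_id)
  have hdxc : Continuous fun x => deriv (ψ 0) x := by
    have : (fun x => deriv (ψ 0) x) = fun x => ψx 0 x := funext fun x => (h2 0 x).deriv
    rw [this]; exact hcx.comp (continuous_const.prodMk continuous_id)
  have hec := Literature.Analysis.PDE.continuous_wave1D_energyDensity hVc hψ
  have hec0 : Continuous fun x => deriv (fun τ => ψ τ x) 0 ^ 2 + deriv (ψ 0) x ^ 2 + V x * ψ 0 x ^ 2 :=
    hec.comp (continuous_const.prodMk continuous_id)
  have he : IntegrableOn (fun x => deriv (fun τ => ψ τ x) 0 ^ 2 + deriv (ψ 0) x ^ 2 + V x * ψ 0 x ^ 2)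
      (Ioi xf) :=
    (integrableOn_of_lintegral_ne_top hec0.aestronglyMeasurable
      (fun x _ => Literature.Analysis.PDE.wave1D_energyDensity_nonneg hV0 0 x) measurableSet_Ioi hfin).1
  have glue : ∀ {f : ℝ → ℝ} {X : ℝ}, Continuous f → IntegrableOn f (Ioi xf) → IntegrableOn f (Ioi X) := by
    intro f X hf hfi
    rcases le_or_gt xf X with h | h
    · exact hfi.mono_set (Ioi_subset_Ioi h)
    · exact integrableOn_Ioi_of_continuousOn_Icc hf.continuousOn hfi
  have hI1 : IntegrableOn (fun x => deriv (fun τ => ψ τ x) 0 ^ 2) (Ioi xf) :=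
    integrableOn_sq_of_le (a := xf) le_rfl hdtc.continuousOn he fun x _ => by
      have := hV0 x; nlinarith [sq_nonneg (deriv (ψ 0) x)]
  have hI2 : IntegrableOn (fun x => deriv (ψ 0) x ^ 2) (Ioi xf) :=
    integrableOn_sq_of_le (a := xf) le_rfl hdxc.continuousOn he fun x _ => by
      have := hV0 x; nlinarith [sq_nonneg (deriv (fun τ => ψ τ x) 0)]
  refine ⟨fun X _ => glue (hdtc.pow 2) hI1, fun X _ => glue (hdxc.pow 2) hI2, fun X _ hX1 => ?_⟩
  have hd : ∀ x, HasDerivAt (ψ 0) (deriv (ψ 0) x) x := fun x => by rw [(h2 0 x).deriv]; exact h2 0 x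
  exact sq_div_integrableOn_of_deriv (lt_of_lt_of_le one_pos hX1) (fun x _ => hd x) hdxc.continuousOn
    (glue (hdxc.pow 2) hI2)

/-- **Stub P — peeling.**  See the module docstring and the crux skeleton. -/
theorem stub_peel :
    ∀ (M : ℝ) (r : ℝ → ℝ) (xc : ℝ), IsTortoiseRadius M r xc → ∀ (s ℓ : ℕ), s ≤ 2 → s ≤ ℓ →
      ∀ (W U : ℕ → ℝ → ℝ) (a : ℝ),
        (∀ x, a < x → U 0 x = linePotential M s ℓ r x) →
        (∀ k, k < ℓ → ∀ x, a < x → HasDerivAt (W k) (U k x - W k x ^ 2) x) →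
        (∀ k, k < ℓ → ∀ x, a < x → U (k + 1) x = 2 * W k x ^ 2 - U k x) →
        (∀ k, k < ℓ → Tendsto (fun x => x * W k x) atTop (𝓝 ((k : ℝ) - ℓ))) →
        (∀ x, a < x → 0 ≤ U ℓ x) →
        ∀ xf : ℝ, a < xf → ∀ ψ : ℝ → ℝ → ℝ, IsRWSolution M s ℓ r ψ →
          farEnergy (linePotential M s ℓ r) xf ψ 0 ≠ ⊤ →
          ∃ (φ : ℝ → ℝ → ℝ) (u : ℝ → ℝ),
            ContDiffOn ℝ 2 (Function.uncurry φ) {z : ℝ × ℝ | a < z.2} ∧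
            (∀ z : ℝ × ℝ, a < z.2 → IsSolutionAt (U ℓ) φ z) ∧
            farEnergy (U ℓ) xf φ 0 ≠ ⊤ ∧
            ContDiffOn ℝ 2 u (Set.Ioi a) ∧
            (∀ x, a < x → iteratedDeriv 2 u x = U ℓ x * u x) ∧
            (∫⁻ x in Set.Ioi xf, ENNReal.ofReal (deriv u x ^ 2 + U ℓ x * u x ^ 2)) ≠ ⊤ ∧
            u xf ≠ 0 ∧
            farChannelEnergy (U ℓ) xf φ atTop ≤ farChannelEnergy (linePotential M s ℓ r) xf ψ atTop ∧
            farChannelEnergy (U ℓ) xf φ atBot ≤ farChannelEnergy (linePotential M s ℓ r) xf ψ atBot ∧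
            (⨅ p ∈ {p : ℝ → ℝ → ℝ |
                IsSolutionOn (linePotential M s ℓ r) p {z : ℝ × ℝ | xf + |z.1| < z.2} ∧
                  IsPolynomialInTimeOn p {z : ℝ × ℝ | xf + |z.1| < z.2}},
              ∫⁻ x in Set.Ioi xf, ENNReal.ofReal
                (energyDensity (linePotential M s ℓ r) (fun t y => ψ t y - p t y) 0 x))
              ≤ ⨅ c : ℝ, ∫⁻ x in Set.Ioi xf, ENNReal.ofReal
                (energyDensity (U ℓ) (fun t y => φ t y - c * u y) 0 x) := by
  intro M r xc hr s ℓ hs2 hsℓ W U a hU0eq hWd hUs hlim hQ0 xf haxf ψ hψ hfin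
  set V : ℝ → ℝ := linePotential M s ℓ r with hV
  have hM := hr.mass_pos
  have hS : IsOpen (Ioi a) := isOpen_Ioi
  -- the potential
  have hVC : ContDiff ℝ ∞ V := KruskalRestFrameVirial.contDiff_linePotential hr s ℓ ⊤
  have hVc : Continuous V := hVC.continuous
  have hVpos : ∀ x, 0 < V x := fun x => rwPotential_pos hM (hr.two_mul_lt x) hs2 hsℓ
  have hV0 : ∀ x, 0 ≤ V x := fun x => (hVpos x).le
  have hVlim := tendsto_sq_mul_linePotential hr s ℓ
  -- the ladder
  have hU0C : ContDiffOn ℝ ∞ (U 0) (Ioi a) := hVC.contDiffOn.congr fun x hx => hU0eq x hx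
  obtain ⟨hUC, hWC⟩ := ladder_contDiffOn hU0C hWd hUs
  have hU0lim : Tendsto (fun x => x ^ 2 * U 0 x) atTop (𝓝 ((ℓ : ℝ) * ((ℓ : ℝ) + 1))) := by
    refine hVlim.congr' ?_
    filter_upwards [eventually_gt_atTop a] with x hx
    rw [hU0eq x hx]
  obtain ⟨X₁, B, C, haX, hX1, hrec, hUB, hUfar⟩ := ladder_thresholds hU0lim hUs hlim
  have hU0all : ∀ k, k ≤ ℓ → ∀ x, X₁ ≤ x → 0 ≤ U k x := by
    intro k hk x hx
    rcases Nat.lt_or_eq_of_le hk with h | h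
    · exact hUfar k h x hx
    · rw [h]; exact hQ0 x (haX.trans_le hx)
  -- the level-`0` state
  have hψC : ContDiffOn ℝ 2 (Function.uncurry ψ) {z : ℝ × ℝ | a < z.2} := hψ.1.contDiffOn
  have hψsol : ∀ t x, a < x →
      iteratedDeriv 2 (fun τ => ψ τ x) t - iteratedDeriv 2 (ψ t) x + U 0 x * ψ t x = 0 := by
    intro t x hx
    rw [hU0eq x hx]
    exact hψ.2 (t, x)
  have hset0 : {x : ℝ | xf + |(0 : ℝ)| < x} = Ioi xf := by ext x; simp
  have hfin' : ∫⁻ x in Ioi xf, ENNReal.ofReal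
      (deriv (fun τ => ψ τ x) 0 ^ 2 + deriv (ψ 0) x ^ 2 + V x * ψ 0 x ^ 2) ≠ ⊤ := by
    have h := hfin
    simp only [farEnergy, energyDensity, hset0] at h
    exact h
  obtain ⟨hψ1, hψ2, hψ3⟩ := initial_integrable (a := a) hVc hV0 hψ.1 hfin'
  -- the chain of rungs
  obtain ⟨θ, hθ0, hlev, hrel, hen⟩ := exists_chain haX hX1 hUC hWC hWd hUs hrec hUB hU0all hψC hψsol
    hψ1 hψ2 hψ3 ℓ le_rfl
  obtain ⟨hφC, hφsol, hφ1, hφ2, hφ3⟩ := hlev ℓ le_rfl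
  -- the static mode
  have hQC : ContDiffOn ℝ ∞ (U ℓ) (Ioi a) := hUC ℓ le_rfl
  obtain ⟨u, huC, hu2, hupos, hule, hdule, huI1, huI2⟩ : ∃ u : ℝ → ℝ, ContDiffOn ℝ ∞ u (Ioi a) ∧
      (∀ x, a < x → iteratedDeriv 2 u x = U ℓ x * u x) ∧ (∀ x, a < x → 0 < u x) ∧
      (∀ x, xf ≤ x → u x ≤ u xf) ∧ (∀ x, xf < x → |deriv u x| ≤ u xf / (x - xf)) ∧
      IntegrableOn (fun x => deriv u x ^ 2) (Ioi xf) ∧ IntegrableOn (fun x => U ℓ x * u x ^ 2) (Ioi xf) := by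
    rcases Nat.eq_zero_or_pos ℓ with hℓ | hℓ
    · subst hℓ
      obtain rfl : s = 0 := Nat.le_zero.1 hsℓ
      obtain ⟨X₀, hX₀, hVB⟩ := linePotential_zero_le hr
      obtain ⟨u, h1, h2, h3, h4, h5, h6, h7⟩ :=
        exists_staticMode_zero (a := a) haxf hX₀ hVC hV0 hVB
      refine ⟨u, h1, fun x hx => by rw [h2 x hx, hU0eq x hx], h3, h4, h5, h6, ?_⟩
      exact h7.congr_fun (fun x hx => by rw [hU0eq x (haxf.trans hx)]) measurableSet_Ioi
    · obtain ⟨l, rfl⟩ : ∃ l, ℓ = l + 1 := ⟨ℓ - 1, by omega⟩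
      have hl : l < l + 1 := Nat.lt_succ_self l
      obtain ⟨w, hw0, hwd, hwC⟩ := exists_seed (hWC l hl)
      exact exists_staticMode_rung haxf haX (by linarith) (hWC l hl) (hWd l hl) (hUs l hl) hQ0
        (fun x hx => (hrec l hl x hx).1) hw0 hwd hwC
  have hu0 : u xf ≠ 0 := (hupos xf haxf).ne'
  have hud : ∀ x, a < x → HasDerivAt u (deriv u x) x := fun x hx =>
    ((huC.differentiableOn (by simp) x hx).differentiableAt (hS.mem_nhds hx)).hasDerivAt
  have hdud : ∀ x, a < x → HasDerivAt (deriv u) (U ℓ x * u x) x := by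
    intro x hx
    have hd : ContDiffOn ℝ ∞ (deriv u) (Ioi a) := huC.deriv_of_isOpen hS le_rfl
    have h := ((hd.differentiableOn (by simp) x hx).differentiableAt (hS.mem_nhds hx)).hasDerivAt
    rwa [← iteratedDeriv_two_eq_deriv_deriv, hu2 x hx] at h
  set c₀ : ℝ := θ ℓ 0 xf / u xf with hc₀
  -- the descent
  have hlev5 : ∀ k, k ≤ ℓ →
      ContDiffOn ℝ 2 (Function.uncurry (θ k)) {z : ℝ × ℝ | a < z.2} ∧
      (∀ X, a < X → IntegrableOn (fun x => deriv (fun τ => θ k τ x) 0 ^ 2) (Ioi X)) ∧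
      (∀ X, a < X → IntegrableOn (fun x => deriv (θ k 0) x ^ 2) (Ioi X)) ∧
      (∀ X, a < X → 1 ≤ X → IntegrableOn (fun x => (θ k 0 x / x) ^ 2) (Ioi X)) ∧
      IntegrableOn (fun x => U k x * θ k 0 x ^ 2) (Ioi xf) := by
    intro k hk
    obtain ⟨h1, h2, h3, h4, h5⟩ := hlev k hk
    obtain ⟨-, -, h6, -⟩ := level_integrable haX hX1 (hUC k hk).continuousOn (hU0all k hk) (hUB k hk)
      h1 h2 h3 h4 h5 0 haxf
    exact ⟨h1, h3, h4, h5, h6⟩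
  obtain ⟨p, hpC, hpsol, hpoly, hE0i, hEℓi, hEq⟩ := exists_descent haxf haX hX1 hUC hWC hWd hUs hrec hUB
    hQ0 hlev5 hrel huC hu2 hupos hule huI1 huI2
  -- slices of `φ = θ ℓ` at `t = 0`
  obtain ⟨hφd, hφdxc, hφdtc, hφt, hφc⟩ := slice_facts hφC
  -- the one-mode deficit: pieces and the minimum at `c₀`
  set f : ℝ → ℝ := fun x => θ ℓ 0 x - c₀ * u x with hf
  set df : ℝ → ℝ := fun x => deriv (θ ℓ 0) x - c₀ * deriv u x with hdf
  set A : ℝ → ℝ := fun x => deriv (fun τ => θ ℓ τ x) 0 with hA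
  have hfd : ∀ x, a < x → HasDerivAt f (df x) x := fun x hx => (hφd x hx).sub ((hud x hx).const_mul c₀)
  have hdfc : ContinuousOn df (Ioi a) :=
    hφdxc.sub (continuousOn_const.mul (huC.continuousOn_deriv_of_isOpen hS (by simp)))
  have hf0 : f xf = 0 := by simp only [hf, hc₀]; field_simp; ring
  have hA2 : IntegrableOn (fun x => A x ^ 2) (Ioi xf) := hφ1 xf haxf
  have hfI1 : IntegrableOn (fun x => df x ^ 2) (Ioi xf) :=
    integrableOn_sq_of_le haxf.le hdfc hEℓi fun x hx => by
      have := hQ0 x (haxf.trans hx); nlinarith [sq_nonneg (A x)]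
  have hfI2 : IntegrableOn (fun x => U ℓ x * f x ^ 2) (Ioi xf) := by
    refine hEℓi.mono' (((hQC.continuousOn.mul ((hφc.sub (continuousOn_const.mul huC.continuousOn)).pow 2)).mono
      (Ioi_subset_Ioi haxf.le)).aestronglyMeasurable measurableSet_Ioi) ?_
    filter_upwards [ae_restrict_mem measurableSet_Ioi] with x hx
    have hQ := hQ0 x (haxf.trans hx)
    rw [Real.norm_eq_abs, abs_of_nonneg (mul_nonneg hQ (sq_nonneg _))]
    nlinarith [sq_nonneg (A x), sq_nonneg (df x)]
  have hmin : ∀ c : ℝ,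
      IntegrableOn (fun x => energyDensity (U ℓ) (fun t y => θ ℓ t y - c * u y) 0 x) (Ioi xf) ∧
      ∫ x in Ioi xf, (A x ^ 2 + df x ^ 2 + U ℓ x * f x ^ 2)
        ≤ ∫ x in Ioi xf, energyDensity (U ℓ) (fun t y => θ ℓ t y - c * u y) 0 x := by
    intro c
    obtain ⟨hint, hle⟩ := deficit_le_of_shift (A := A) haxf hQC.continuousOn hQ0 hud hdud hupos hdule
      huI1 huI2 hfd hdfc hf0 hfI1 hfI2 hA2 (c - c₀)
    have hident : ∀ x, a < x → energyDensity (U ℓ) (fun t y => θ ℓ t y - c * u y) 0 x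
        = A x ^ 2 + (df x - (c - c₀) * deriv u x) ^ 2 + U ℓ x * (f x - (c - c₀) * u x) ^ 2 := by
      intro x hx
      have e1 : deriv (fun τ => θ ℓ τ x - c * u x) 0 = A x := by
        simp only [hA]; rw [deriv_sub_const]
      have e2 : deriv (fun y => θ ℓ 0 y - c * u y) x = deriv (θ ℓ 0) x - c * deriv u x := by
        have hd : HasDerivAt (fun y => θ ℓ 0 y - c * u y) (deriv (θ ℓ 0) x - c * deriv u x) x :=
          (hφd x hx).sub ((hud x hx).const_mul c)
        exact hd.deriv
      simp only [energyDensity, e1, e2, hdf, hf]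
      ring
    refine ⟨hint.congr_fun (fun x hx => (hident x (haxf.trans hx)).symm) measurableSet_Ioi, ?_⟩
    rw [setIntegral_congr_fun measurableSet_Ioi fun x hx => hident x (haxf.trans hx)]
    exact hle
  -- the kernel element `p`
  have hpK : p ∈ {p : ℝ → ℝ → ℝ | IsSolutionOn V p {z : ℝ × ℝ | xf + |z.1| < z.2} ∧
      IsPolynomialInTimeOn p {z : ℝ × ℝ | xf + |z.1| < z.2}} := by
    have hsub : {z : ℝ × ℝ | xf + |z.1| < z.2} ⊆ {z : ℝ × ℝ | a < z.2} := fun z hz => by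
      have h : xf + |z.1| < z.2 := hz
      have := abs_nonneg z.1
      show a < z.2
      linarith
    refine ⟨⟨hpC.mono hsub, fun z hz => ?_⟩, ?_⟩
    · have hz' : a < z.2 := hsub hz
      show iteratedDeriv 2 (fun τ => p τ z.2) z.1 - iteratedDeriv 2 (p z.1) z.2 + V z.2 * p z.1 z.2 = 0
      rw [show V z.2 = U 0 z.2 from (hU0eq z.2 hz').symm]
      exact hpsol z.1 z.2 hz'
    · obtain ⟨N, cf, hcf⟩ := hpoly
      exact ⟨N, cf, fun z _ => hcf z.1 z.2⟩
  -- energies as real integrals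
  have hEψ : ∫⁻ x in Ioi xf, ENNReal.ofReal (energyDensity V (fun t y => ψ t y - p t y) 0 x)
      = ENNReal.ofReal (∫ x in Ioi xf, (A x ^ 2 + df x ^ 2 + U ℓ x * f x ^ 2)) := by
    have hident : ∀ x, a < x → energyDensity V (fun t y => ψ t y - p t y) 0 x
        = deriv (fun τ => θ 0 τ x - p τ x) 0 ^ 2 + deriv (fun y => θ 0 0 y - p 0 y) x ^ 2
          + U 0 x * (θ 0 0 x - p 0 x) ^ 2 := by
      intro x hx
      simp only [energyDensity, hθ0, hU0eq x hx]
    rw [setLIntegral_congr_fun measurableSet_Ioi fun x hx => by rw [hident x (haxf.trans hx)],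
      lintegral_eq_ofReal_of_integrableOn measurableSet_Ioi hE0i fun x hx => ?_, hEq]
    have := hVpos x
    rw [← hident x (haxf.trans hx)]
    exact energyDensity_nonneg _ _ (hV0 x)
  -- the far energies at time `t` beyond `X₁`
  have hfar : ∀ t : ℝ, X₁ ≤ xf + |t| → farEnergy (U ℓ) xf (θ ℓ) t ≤ farEnergy V xf ψ t := by
    intro t ht
    obtain ⟨hiℓ, hleℓ⟩ := hen ℓ le_rfl t (xf + |t|) ht
    obtain ⟨hi0, -⟩ := hen 0 (Nat.zero_le _) t (xf + |t|) ht
    have hnnℓ : ∀ x ∈ Ioi (xf + |t|), 0 ≤ deriv (fun τ => θ ℓ τ x) t ^ 2 + deriv (θ ℓ t) x ^ 2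
        + U ℓ x * θ ℓ t x ^ 2 := fun x hx => by
      have := hQ0 x (by have := abs_nonneg t; linarith [mem_Ioi.1 hx]); positivity
    have hnn0 : ∀ x ∈ Ioi (xf + |t|), 0 ≤ deriv (fun τ => θ 0 τ x) t ^ 2 + deriv (θ 0 t) x ^ 2
        + U 0 x * θ 0 t x ^ 2 := fun x hx => by
      have hxa : a < x := by have := abs_nonneg t; linarith [mem_Ioi.1 hx]
      rw [hU0eq x hxa]; have := hV0 x; positivity
    show (∫⁻ x in Ioi (xf + |t|), ENNReal.ofReal (energyDensity (U ℓ) (θ ℓ) t x))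
      ≤ ∫⁻ x in Ioi (xf + |t|), ENNReal.ofReal (energyDensity V ψ t x)
    simp only [energyDensity]
    rw [lintegral_eq_ofReal_of_integrableOn measurableSet_Ioi hiℓ hnnℓ]
    have e0 : ∫⁻ x in Ioi (xf + |t|), ENNReal.ofReal (deriv (fun τ => ψ τ x) t ^ 2 + deriv (ψ t) x ^ 2
        + V x * ψ t x ^ 2) = ∫⁻ x in Ioi (xf + |t|), ENNReal.ofReal (deriv (fun τ => θ 0 τ x) t ^ 2
        + deriv (θ 0 t) x ^ 2 + U 0 x * θ 0 t x ^ 2) := by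
      refine setLIntegral_congr_fun measurableSet_Ioi fun x hx => ?_
      have hxa : a < x := by have := abs_nonneg t; linarith [mem_Ioi.1 hx]
      rw [hθ0, hU0eq x hxa]
    rw [e0, lintegral_eq_ofReal_of_integrableOn measurableSet_Ioi hi0 hnn0]
    exact ENNReal.ofReal_le_ofReal hleℓ
  -- finiteness of the far energy of `φ` at `t = 0`
  obtain ⟨-, -, -, heφ⟩ := level_integrable haX hX1 hQC.continuousOn (hU0all ℓ le_rfl) (hUB ℓ le_rfl)
    hφC hφsol hφ1 hφ2 hφ3 0 haxf
  refine ⟨θ ℓ, u, hφC, fun z hz => hφsol z.1 z.2 hz, ?_, huC.of_le (WithTop.coe_le_coe.2 le_top), hu2, ?_,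
    hu0, ?_, ?_, ?_⟩
  · -- far energy of `φ` at `t = 0`
    show (∫⁻ x in {x : ℝ | xf + |(0 : ℝ)| < x}, ENNReal.ofReal (energyDensity (U ℓ) (θ ℓ) 0 x)) ≠ ⊤
    rw [hset0]
    simp only [energyDensity]
    rw [lintegral_eq_ofReal_of_integrableOn measurableSet_Ioi heφ fun x hx => by
      have := hQ0 x (haxf.trans hx); positivity]
    exact ENNReal.ofReal_ne_top
  · -- static energy of `u`
    have hI : IntegrableOn (fun x => deriv u x ^ 2 + U ℓ x * u x ^ 2) (Ioi xf) := huI1.add huI2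
    rw [lintegral_eq_ofReal_of_integrableOn measurableSet_Ioi hI fun x hx => by
      have := hQ0 x (haxf.trans hx); positivity]
    exact ENNReal.ofReal_ne_top
  · -- forward channel
    refine Filter.liminf_le_liminf ?_
    filter_upwards [Filter.eventually_ge_atTop (X₁ - xf)] with t ht
    exact hfar t (by have := le_abs_self t; linarith)
  · -- backward channel
    refine Filter.liminf_le_liminf ?_
    filter_upwards [Filter.eventually_le_atBot (xf - X₁)] with t ht
    exact hfar t (by have := neg_le_abs t; linarith)
  · -- the deficit
    refine (iInf₂_le p hpK).trans ?_
    rw [hEψ]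
    refine le_iInf fun c => ?_
    obtain ⟨hint, hle⟩ := hmin c
    rw [lintegral_eq_ofReal_of_integrableOn measurableSet_Ioi hint fun x hx =>
      energyDensity_nonneg _ _ (hQ0 x (haxf.trans hx))]
    exact ENNReal.ofReal_le_ofReal hle

end Summit.FinalStateConjecture.FinalStateConjecture.Theorems.CrumPeelingRecessiveTower
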